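import Summits.Ventures.HodgeRepro2.T5HeckePermutationModule
import Summits.Ventures.HodgeRepro2.T5HeckeDoubleCoset
import Summits.Ventures.HodgeRepro2.T5HeckeDoubleCosetBasis

/-!
# The convolution product of `H(G, K)` without Haar measure

`T5HeckePermutationModule` realises the Hecke algebra as `H(G, K) = End_G(k[G/K])` and identifies
it, as a `k`-module, with the `K`-fixed vectors `k[G/K]^K` through `T ↦ T(δ_K)`.  This file
transports the PRODUCT.  Writing `t = T(δ_K)` and `s = S(δ_K)`, equivariance gives
`T(δ_{xK}) = x · t`, hence

  `(T ∘ S)(δ_K) = T (Σ_{xK} s(xK) δ_{xK}) = Σ_{xK ∈ G/K} s(xK) · (x · t)`,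

i.e. in coefficients `(t * s)(zK) = Σ_{xK ∈ G/K} s(xK) t(x⁻¹ z K)`: the convolution product of
`K`-bi-invariant functions on `G` for the COUNTING measure on `G/K` — the Haar convolution with
the normalisation `vol(K) = 1`, without any measure.  The matrix entry of `T` at `(zK, xK)` is
`t(x⁻¹ z K)`, `δ_K` is the unit, and the structure constants of the double-coset basis are
`T_g T_h = Σ_{zK} #{xK ∈ KhK/K : x⁻¹ z ∈ KgK} · δ_{zK}`.

Everything is a finite sum over `G/K`; no topology, no measure, no Haar normalisation.
-/

namespace Summit.Ventures.HodgeRepro2.T5HeckeConvolution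

open T5HeckePermutationModule T5HeckeDoubleCoset T5HeckeDoubleCosetBasis LevelPositivity

variable {G : Type*} [Group G] {k : Type*} [Field k] {K : Subgroup G}

/-- An element of the Hecke algebra commutes with the permutation action of every `x : G`
(this is the definition of `H(G, K)` as the centraliser of the `G`-action). -/
theorem apply_ofMulAction (T : heckeAlgebra k K) (x : G) (f : MonoidAlgebra k (G ⧸ K)) :
    (T : Module.End k (MonoidAlgebra k (G ⧸ K))) (Representation.ofMulAction k G (G ⧸ K) x f) =
      Representation.ofMulAction k G (G ⧸ K) x
        ((T : Module.End k (MonoidAlgebra k (G ⧸ K))) f) := by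
  have h := (mem_heckeAlgebra_iff.1 T.2) x
  have h' := congrArg (fun S : Module.End k (MonoidAlgebra k (G ⧸ K)) => S f) h
  simp only [Module.End.mul_apply] at h'
  exact h'.symm

/-- The basis vector `δ_{xK}` is the translate of `δ_K` by `x`. -/
theorem single_mk_eq (x : G) (c : k) :
    MonoidAlgebra.single ((x : G ⧸ K)) c =
      Representation.ofMulAction k G (G ⧸ K) x
        (MonoidAlgebra.single ((1 : G) : G ⧸ K) c) := by
  rw [Representation.ofMulAction_single, MulAction.Quotient.smul_mk, smul_eq_mul, mul_one]

/-- Equivariance: `T(δ_{xK}) = x · T(δ_K)` for every `T ∈ H(G, K)`. -/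
theorem apply_single_mk (T : heckeAlgebra k K) (x : G) (c : k) :
    (T : Module.End k (MonoidAlgebra k (G ⧸ K))) (MonoidAlgebra.single (x : G ⧸ K) c) =
      Representation.ofMulAction k G (G ⧸ K) x
        ((T : Module.End k (MonoidAlgebra k (G ⧸ K)))
          (MonoidAlgebra.single ((1 : G) : G ⧸ K) c)) := by
  rw [single_mk_eq, apply_ofMulAction]

/-- Equivariance through a chosen representative `Quotient.out x` of a coset `x : G ⧸ K`. -/
theorem apply_single (T : heckeAlgebra k K) (x : G ⧸ K) (c : k) :
    (T : Module.End k (MonoidAlgebra k (G ⧸ K))) (MonoidAlgebra.single x c) =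
      Representation.ofMulAction k G (G ⧸ K) (Quotient.out x)
        ((T : Module.End k (MonoidAlgebra k (G ⧸ K)))
          (MonoidAlgebra.single ((1 : G) : G ⧸ K) c)) := by
  conv_lhs => rw [← QuotientGroup.out_eq' x]
  exact apply_single_mk T _ c

/-- THE MATRIX ENTRIES OF `T ∈ H(G, K)`: the coefficient of `T(δ_{xK})` at `zK` is
`t(x⁻¹ z K)`, where `t = T(δ_K)`. -/
theorem coeff_apply_single_mk (T : heckeAlgebra k K) (x : G) (c : k) (z : G ⧸ K) :
    ((T : Module.End k (MonoidAlgebra k (G ⧸ K)))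
        (MonoidAlgebra.single (x : G ⧸ K) c)).coeff z =
      ((T : Module.End k (MonoidAlgebra k (G ⧸ K)))
        (MonoidAlgebra.single ((1 : G) : G ⧸ K) c)).coeff (x⁻¹ • z) := by
  rw [apply_single_mk, Representation.coeff_ofMulAction]

/-- The product of two elements of `H(G, K)`, evaluated at `δ_K`: `(T ∘ S)(δ_K)` is the
`k`-linear combination `Σ_{xK} (S δ_K)(xK) · T(δ_{xK})`. -/
theorem mul_apply_single_one (T S : heckeAlgebra k K) :
    ((T * S : heckeAlgebra k K) : Module.End k (MonoidAlgebra k (G ⧸ K)))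
        (MonoidAlgebra.single ((1 : G) : G ⧸ K) (1 : k)) =
      ((S : Module.End k (MonoidAlgebra k (G ⧸ K)))
          (MonoidAlgebra.single ((1 : G) : G ⧸ K) (1 : k))).coeff.sum
        fun x c => c • (T : Module.End k (MonoidAlgebra k (G ⧸ K))) (MonoidAlgebra.single x 1) := by
  rw [Subalgebra.coe_mul, Module.End.mul_apply]
  conv_lhs =>
    rw [← MonoidAlgebra.sum_coeff_single ((S : Module.End k (MonoidAlgebra k (G ⧸ K)))
      (MonoidAlgebra.single ((1 : G) : G ⧸ K) (1 : k)))]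
  rw [map_finsuppSum]
  refine Finsupp.sum_congr fun x _ => ?_
  rw [← map_smul, MonoidAlgebra.smul_single, smul_eq_mul, mul_one]

/-- THE CONVOLUTION PRODUCT for the counting measure on `G/K`:
`conv t s = Σ_{xK ∈ G/K} s(xK) · (x · t)`, the representative `x = Quotient.out xK` being
irrelevant when `t` is `K`-invariant (`coeff_inv_out_smul`). -/
noncomputable def conv (t s : MonoidAlgebra k (G ⧸ K)) : MonoidAlgebra k (G ⧸ K) :=
  s.coeff.sum fun x c => c • Representation.ofMulAction k G (G ⧸ K) (Quotient.out x) t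

/-- THE PRODUCT OF `H(G, K)` IS THE CONVOLUTION: `(T ∘ S)(δ_K) = conv (T δ_K) (S δ_K)`. -/
theorem mul_apply_single_one_eq_conv (T S : heckeAlgebra k K) :
    ((T * S : heckeAlgebra k K) : Module.End k (MonoidAlgebra k (G ⧸ K)))
        (MonoidAlgebra.single ((1 : G) : G ⧸ K) (1 : k)) =
      conv ((T : Module.End k (MonoidAlgebra k (G ⧸ K)))
          (MonoidAlgebra.single ((1 : G) : G ⧸ K) (1 : k)))
        ((S : Module.End k (MonoidAlgebra k (G ⧸ K)))
          (MonoidAlgebra.single ((1 : G) : G ⧸ K) (1 : k))) := by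
  rw [mul_apply_single_one]
  refine Finsupp.sum_congr fun x _ => ?_
  rw [apply_single T x]

/-- The same statement through the linear equivalence `H(G, K) ≃ k[G/K]^K` of
`T5HeckePermutationModule`: the image of a product is the convolution of the images. -/
theorem coe_heckeAlgebraEquivInvariants_mul (T S : heckeAlgebra k K) :
    ((heckeAlgebraEquivInvariants (T * S) :
        invariants (Representation.ofMulAction k G (G ⧸ K)) K) : MonoidAlgebra k (G ⧸ K)) =
      conv (heckeAlgebraEquivInvariants T) (heckeAlgebraEquivInvariants S) := by
  rw [heckeAlgebraEquivInvariants_apply, heckeAlgebraEquivInvariants_apply,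
    heckeAlgebraEquivInvariants_apply, mul_apply_single_one_eq_conv]

/-- The convolution of two `K`-invariant vectors is `K`-invariant (it is `(T ∘ S)(δ_K)`). -/
theorem conv_mem_invariants {t s : MonoidAlgebra k (G ⧸ K)}
    (ht : t ∈ invariants (Representation.ofMulAction k G (G ⧸ K)) K)
    (hs : s ∈ invariants (Representation.ofMulAction k G (G ⧸ K)) K) :
    conv t s ∈ invariants (Representation.ofMulAction k G (G ⧸ K)) K := by
  have h := coe_heckeAlgebraEquivInvariants_mul
    (heckeAlgebraEquivInvariants (K := K) (k := k).symm ⟨t, ht⟩)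
    (heckeAlgebraEquivInvariants (K := K) (k := k).symm ⟨s, hs⟩)
  rw [LinearEquiv.apply_symm_apply, LinearEquiv.apply_symm_apply] at h
  simp only at h
  rw [← h]
  exact Subtype.coe_prop _

/-- THE COEFFICIENT FORMULA: `(conv t s)(zK) = Σ_{xK} s(xK) · t(x⁻¹ z K)` with `x = Quotient.out xK`. -/
theorem coeff_conv (t s : MonoidAlgebra k (G ⧸ K)) (z : G ⧸ K) :
    (conv t s).coeff z = s.coeff.sum fun x c => c * t.coeff ((Quotient.out x)⁻¹ • z) := by
  unfold conv
  rw [MonoidAlgebra.coeff_finsuppSum, Finsupp.sum_apply]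
  refine Finsupp.sum_congr fun x _ => ?_
  rw [MonoidAlgebra.coeff_smul, Finsupp.smul_apply, Representation.coeff_ofMulAction, smul_eq_mul]

/-- For a `K`-invariant `t` the value `t(x⁻¹ z K)` does not depend on the representative `x`
of the coset `xK`: the representative `Quotient.out (xK)` may be replaced by `x`. -/
theorem coeff_inv_out_smul {t : MonoidAlgebra k (G ⧸ K)}
    (ht : t ∈ invariants (Representation.ofMulAction k G (G ⧸ K)) K) (x : G) (z : G ⧸ K) :
    t.coeff ((Quotient.out (x : G ⧸ K))⁻¹ • z) = t.coeff (x⁻¹ • z) := by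
  have hmem : (Quotient.out (x : G ⧸ K))⁻¹ * x ∈ K :=
    QuotientGroup.eq.1 (QuotientGroup.out_eq' (x : G ⧸ K))
  have hκ := (mem_invariants_ofMulAction_iff.1 ht) _ hmem (x⁻¹ • z)
  rw [← hκ, smul_smul, mul_assoc, mul_inv_cancel, mul_one]

/-- THE COEFFICIENT FORMULA, representative-free form: for `K`-invariant `t` and a coset
`s = c · δ_{xK}` the convolution is `c · t(x⁻¹ z K)` at `zK`. -/
theorem coeff_conv_single_mk {t : MonoidAlgebra k (G ⧸ K)}
    (ht : t ∈ invariants (Representation.ofMulAction k G (G ⧸ K)) K) (x : G) (c : k)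
    (z : G ⧸ K) :
    (conv t (MonoidAlgebra.single (x : G ⧸ K) c)).coeff z = c * t.coeff (x⁻¹ • z) := by
  rw [coeff_conv, MonoidAlgebra.coeff_single, Finsupp.sum_single_index (by simp),
    coeff_inv_out_smul ht]

/-- `δ_K` is a left unit for the convolution: `conv δ_K s = s`. -/
theorem conv_single_one_left (s : MonoidAlgebra k (G ⧸ K)) :
    conv (MonoidAlgebra.single ((1 : G) : G ⧸ K) (1 : k)) s = s := by
  unfold conv
  conv_rhs => rw [← MonoidAlgebra.sum_coeff_single s]
  refine Finsupp.sum_congr fun x _ => ?_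
  rw [Representation.ofMulAction_single, MulAction.Quotient.smul_mk, smul_eq_mul, mul_one,
    QuotientGroup.out_eq', MonoidAlgebra.smul_single, smul_eq_mul, mul_one]

/-- A `K`-invariant vector of `k[G/K]` is fixed by every element of `K`, coefficientwise. -/
theorem ofMulAction_eq_self_of_mem {t : MonoidAlgebra k (G ⧸ K)}
    (ht : t ∈ invariants (Representation.ofMulAction k G (G ⧸ K)) K) {κ : G} (hκ : κ ∈ K) :
    Representation.ofMulAction k G (G ⧸ K) κ t = t :=
  mem_invariants_iff.1 ht κ hκ

/-- `δ_K` is a right unit for the convolution on `K`-invariant vectors: `conv t δ_K = t`. -/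
theorem conv_single_one_right {t : MonoidAlgebra k (G ⧸ K)}
    (ht : t ∈ invariants (Representation.ofMulAction k G (G ⧸ K)) K) :
    conv t (MonoidAlgebra.single ((1 : G) : G ⧸ K) (1 : k)) = t := by
  unfold conv
  rw [MonoidAlgebra.coeff_single, Finsupp.sum_single_index (by simp), one_smul]
  have hmem : Quotient.out ((1 : G) : G ⧸ K) ∈ K := by
    have h : (Quotient.out ((1 : G) : G ⧸ K))⁻¹ * 1 ∈ K :=
      QuotientGroup.eq.1 (QuotientGroup.out_eq' ((1 : G) : G ⧸ K))
    rwa [mul_one, K.inv_mem_iff] at h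
  exact ofMulAction_eq_self_of_mem ht hmem

/-- The unit of `H(G, K)` corresponds to `δ_K` (so `conv` has the unit of the algebra). -/
theorem one_apply_single_one :
    ((1 : heckeAlgebra k K) : Module.End k (MonoidAlgebra k (G ⧸ K)))
        (MonoidAlgebra.single ((1 : G) : G ⧸ K) (1 : k)) =
      MonoidAlgebra.single ((1 : G) : G ⧸ K) (1 : k) := by
  rw [Subalgebra.coe_one, Module.End.one_apply]

/-- The coefficient `(orbitVector O)(x)` is `1` on `O` and `0` off `O` (a restatement of
`T5HeckeDoubleCosetBasis.coeff_orbitVector` with the indicator unfolded). -/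
theorem coeff_orbitVector_eq_ite {O : Set (G ⧸ K)} (hO : O.Finite) (x : G ⧸ K) [Decidable (x ∈ O)] :
    (orbitVector k K O).coeff x = if x ∈ O then 1 else 0 := by
  rw [coeff_orbitVector k K hO, Set.indicator_apply]
  simp only [Pi.one_apply]

/-- THE STRUCTURE CONSTANTS OF THE DOUBLE-COSET BASIS (counting form): the coefficient of
`1_{KgK} * 1_{KhK}` at `zK` is the number of cosets `xK ∈ KhK/K` with `x⁻¹ z K ∈ KgK/K`. -/
theorem coeff_conv_orbitVector (g h : G) [Finite (MulAction.orbit K (g : G ⧸ K))]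
    [Finite (MulAction.orbit K (h : G ⧸ K))] (z : G ⧸ K) :
    (conv (orbitVector k K (MulAction.orbit K (g : G ⧸ K)))
        (orbitVector k K (MulAction.orbit K (h : G ⧸ K)))).coeff z =
      (((MulAction.orbit K (h : G ⧸ K)) ∩
        {x | (Quotient.out x)⁻¹ • z ∈ MulAction.orbit K (g : G ⧸ K)}).ncard : k) := by
  classical
  have hg : (MulAction.orbit K (g : G ⧸ K)).Finite := Set.toFinite _
  have hh : (MulAction.orbit K (h : G ⧸ K)).Finite := Set.toFinite _
  rw [coeff_conv]
  have hsupp : (orbitVector k K (MulAction.orbit K (h : G ⧸ K))).coeff.support ⊆ hh.toFinset := by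
    intro x hx
    rw [Finsupp.mem_support_iff] at hx
    rw [Set.Finite.mem_toFinset]
    by_contra hc
    exact hx (by rw [coeff_orbitVector k K hh, Set.indicator_of_notMem hc])
  rw [Finsupp.sum_of_support_subset _ hsupp _ (fun x _ => by rw [zero_mul])]
  have key : ∀ x ∈ hh.toFinset,
      (orbitVector k K (MulAction.orbit K (h : G ⧸ K))).coeff x *
          (orbitVector k K (MulAction.orbit K (g : G ⧸ K))).coeff ((Quotient.out x)⁻¹ • z) =
        if (Quotient.out x)⁻¹ • z ∈ MulAction.orbit K (g : G ⧸ K) then 1 else 0 := by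
    intro x hx
    rw [Set.Finite.mem_toFinset] at hx
    rw [coeff_orbitVector_eq_ite hh, coeff_orbitVector_eq_ite hg, if_pos hx, one_mul]
  rw [Finset.sum_congr rfl key, Finset.sum_boole]
  congr 1
  rw [← Set.ncard_coe_finset]
  congr 1
  ext x
  simp only [Finset.coe_filter, Set.Finite.mem_toFinset, Set.mem_inter_iff, Set.mem_setOf_eq]

/-- THE STRUCTURE CONSTANTS IN THE ALGEBRA: `(T_g ∘ T_h)(δ_K)` has coefficient
`#{xK ∈ KhK/K : x⁻¹ z K ∈ KgK/K}` at `zK`, for the double-coset operators of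
`T5HeckeDoubleCoset`. -/
theorem coeff_doubleCosetOp_mul_apply_single_one (g h : G)
    [Finite (MulAction.orbit K (g : G ⧸ K))] [Finite (MulAction.orbit K (h : G ⧸ K))]
    (z : G ⧸ K) :
    (((doubleCosetOp k K g * doubleCosetOp k K h : heckeAlgebra k K) :
        Module.End k (MonoidAlgebra k (G ⧸ K)))
        (MonoidAlgebra.single ((1 : G) : G ⧸ K) (1 : k))).coeff z =
      (((MulAction.orbit K (h : G ⧸ K)) ∩
        {x | (Quotient.out x)⁻¹ • z ∈ MulAction.orbit K (g : G ⧸ K)}).ncard : k) := by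
  rw [mul_apply_single_one_eq_conv, doubleCosetOp_apply_single_one, doubleCosetOp_apply_single_one,
    coeff_conv_orbitVector]

end Summit.Ventures.HodgeRepro2.T5HeckeConvolution
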